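import Literature.Barriers.CriticalPhenomena.SupercriticalSAWSpaceFillingSteps
import Literature.Probability.RandomPlanarGeometry.SupercriticalSAWPolygons
import HarnessLib

/-!
# Supercritical self-avoiding walks are space-filling (Duminil-Copin–Kozma–Yadin 2014):
# the objects of §3 (boxes with moats, merged polygons, deep boxes) and the Claim of the proof
# of Proposition 7, for the `m`-box route to Theorem 6 for the unit disk

Companion of `SupercriticalSAWSpaceFillingSteps.lean` (which vendors Theorem 6 of H. Duminil-Copin,
G. Kozma, A. Yadin, *Supercritical self-avoiding walks are space-filling*, Ann. IHP Probab. Stat.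
50 (2014) 315–326, arXiv:1110.3074, for `Ω = 𝔻` as the named fact `DKY2014_thm6_disk`, and
proves Theorem 1 from it). This file sets up the objects of the printed proof of Theorem 6 (§3:
Proposition 7 with its Claim, the link polygon `ℓ(γ)`, and the Peierls sum over connected
families of untouched `m`-boxes) in the form in which the `m`-box route is carried out for the
disk in `SupercriticalSAWSpaceFillingPeierls.lean` (`DKY2014_thm6_disk_of_facts`, a conditional
reduction), and records one of its analytic inputs as a named fact:

* `DKY2014_prop7_claim` — the Claim in the proof of Proposition 7 ("for `F ∈ 𝓕(Ω_δ,m)`,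
  `Z_F(x) ≥ Z_m(x)^{|F|}`": merging polygons of `P_m` placed in the boxes of a connected family
  along adjacent cardinal edges), here for boxes with a moat of width `g` around an inner box
  carrying the polygon of `P_n` (each merge then costs `4g` extra edges); PROVED as
  `DKY2014_prop7_claim_holds` in `SupercriticalSAWSpaceFillingBoxesProofs.lean`.

The two other inputs of the assembly are explicit hypotheses of `DKY2014_thm6_disk_of_facts`
(`SupercriticalSAWSpaceFillingPeierls.lean`), NOT named facts (D-0026):

* `hA2` — Proposition 7 for `Ω = 𝔻` ("`P(bdist(γ_δ, V_F) = 1) ≤ C(x,m) Z_m(x)^{-|F|}`",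
  box-distance `1` = `γ_δ` avoids the boxes of `F` and meets a box adjacent to `F`), for
  families of boxes lying `2N` deep inside `𝔻_δ` and endpoints `a_δ, b_δ` near `∂𝔻_δ`, in the
  multiplicative form `weight(event) · Z_{S_F}(x) ≤ C · Z_{(𝔻_δ,a_δ,b_δ)}(x)` produced by the
  printed map `f(γ₁, γ₂) = γ₁ Δ ℓ(γ₁) Δ γ₂`, over the boxes with moat `g = 2` below. Its
  printed proof rests on "One can easily check that such a polygon [the link `ℓ(γ)`] always
  exists", in the moat geometry a case analysis of its own; the tree proves Proposition 7 in
  odd-tile form instead (`mainEvent_bound`, `SupercriticalSAWSpaceFillingTilesSurgery.lean`, the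
  link realised by the `ℓ¹`-sphere templates of
  `Literature/Probability/RandomPlanarGeometry/SAWSphereCover.lean`); formerly recorded here as
  a named fact `DKY2014_prop7_disk`, removed as an intermediate of this route only;
* `hC` — the estimate for the case, not treated in print, in which `γ_δ` meets NO deep box (the
  printed sentence "the box-distance between the union of boxes and `γ_δ` is 1" presumes that
  `γ_δ` meets some `m`-box; a walk creeping along `∂𝔻_δ` need not); not a statement of the
  source. The tile form of the proof treats that case in its own geometry (`annEvent_bound`,
  `SupercriticalSAWSpaceFillingTilesAnnulus.lean`).

The tile form proves Theorem 6 for the disk unconditionally (`DKY2014_thm6_disk_holds`,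
`SupercriticalSAWSpaceFillingTilesTheorem6.lean`), hence Theorem 1 (`DKY2014_thm1_holds`).

## What the source prints (§3)

* "A cardinal edge of a (square) box `B` of side length `2m+1` is an edge of the lattice in the
  middle of one of the sides of `B`. … two boxes `B` and `B'` of side length `2m+1` are said to
  be adjacent if they are disjoint and each has a cardinal edge, `[xy]` and `[zt]` respectively,
  such that `x ∼ z`, `y ∼ t` … we will assume that all our boxes have their lower left corner in
  `(2m+2)δℤ²`."
* Proposition 7 and its proof: "let `𝓔𝓒_F` be the set of external cardinal edges of `F` i.e.
  all cardinal edges in boxes of `F` which have neighbors outside of `F`. Let `S_F` be the set of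
  self-avoiding polygons included in `𝓔_F` visiting all the edges in `𝓔𝓒_F`. Let `Z_F(x)` be
  the partition function of polygons in `S_F`." Claim: "`Z_F(x) ≥ Z_m(x)^{|F|}`" (induction on
  `|F|`, removing a box `B` with `F ∖ {B}` connected: "by changing the edges `[cd]` and `[ab]`
  of `γ` and `γ'` into the edges `[ac]` and `[bd]`, one obtains a polygon in `S_F`"). Then the
  link `ℓ(γ)` ("it contains `e` and is included in `(Ω_δ ∖ 𝓔_F) ∪ {e}`, it intersects `γ`
  either at just one edge, or at two adjacent edges only, it has length smaller than `100m`
  … One can easily check that such a polygon always exists"), the map `f`, and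
  "`Z_{Θ_F}(x) Z_F(x) ≤ 4^{100m} max(x⁶, x^{-100m+4}) Z_{(Ω_δ,a_δ,b_δ)}(x)`".
* Proof of Theorem 6: "there must exist a connected family of at least `s/(2m+1)²` boxes of size
  `2m+1` covering `S` and not intersecting `γ_δ`. We may assume this family is maximal … Since
  the family of boxes is maximal, and because of the condition of the theorem that the family
  of all boxes is connected, the box-distance between the union of boxes and `γ_δ` is 1."

## Design (deviations from print, and why)

* **Moats.** With the printed `S_F` (polygons anywhere in the boxes of `F`) and a fixed external
  cardinal edge `e`, the link polygon need not exist: if `γ_δ` passes through the two sites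
  facing the endpoints of `e` at two non-consecutive times, no polygon through `e` avoiding
  `𝓔_F ∖ {e}` meets `γ_δ` in one edge or two adjacent edges. Here every box `B(z)` (side `2m+2`
  sites, `m = n + g`, corners on `(2m+2)ℤ²`, the tree's `mBox m z`) carries an inner box
  (`innerBox`, side `2n+2`, a translate of `[0,2n+1]²`) surrounded by a moat of width `g`; the
  polygons live in the inner boxes and in the rungs (`rungCells`) joining the inner cardinal
  edges (`innerCardinalEdge`) of adjacent boxes of `F` (`polygonRegion`, `familyPolygons`), so
  the moat of an untouched box is free of both `γ_δ` and the polygon, which is the room the link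
  needs (`g ≥ 2`).
* **Deep boxes.** Near `∂𝔻` the `m`-boxes do not cover `𝔻_δ` and there is no room around a box;
  the Peierls argument is run over the boxes whose `2N`-thickening lies in `𝔻_δ` (`IsDeep`,
  `deepBoxes`, `N = 2m+2`), a family that is connected and closed under moving towards the
  origin; holes near the boundary are pushed inwards first (in the assembly file). The
  endpoints `a_δ, b_δ` are within `3δ` of `∂𝔻` (`IsClosestSite.dist_le`), whence `NearOutside`.
* **The boundary layer.** If `γ_δ` meets no deep box, the maximal untouched family is the family
  of all deep boxes and has no touched neighbour: this case is the hypothesis `hC` of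
  `DKY2014_thm6_disk_of_facts` (see above; formerly recorded here as a named fact
  `DKY2014_thm6_boundaryLayer`, removed because it is not printed in the source).
* Events are subsets of `DomainSAW unitDisk δ u v` measured by `weightAt x` (unnormalised
  weights `x^{|γ|}`), so that "`P(A) ≤ B`" reads `weightAt(A) ≤ B · weightAt(univ)`.
-/

noncomputable section

open MeasureTheory Literature.Probability.LatticeModels Literature.Probability.Percolation
  Literature.Probability.RandomPlanarGeometry.SAW
open scoped ENNReal

namespace Literature.Barriers.CriticalPhenomena

namespace SupercriticalSAW

/-! ### Boxes with moats: inner boxes, inner cardinal edges, rungs -/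

/-- The lower-left corner `N z + (g, g)` of the inner box of the box `B(z)` (`N = 2(n+g)+2`).
[cite: DuminilCopinKozmaYadin2014, §3 (m-boxes)] -/
def innerCorner (n g : ℕ) (z : Site 2) : Site 2 :=
  (2 * ((n + g : ℕ) : ℤ) + 2) • z + fun _ => (g : ℤ)

/-- The inner box of `B(z) = mBox (n+g) z`: the translate of the square `[0, 2n+1]²` by
`innerCorner n g z`, i.e. `B(z)` shrunk by the moat width `g` on every side; it carries the
polygons of `P_n`. [cite: DuminilCopinKozmaYadin2014, §3 (m-boxes) and §2 (P_m)] -/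
def innerBox (n g : ℕ) (z : Site 2) : Finset (Site 2) :=
  (squareBox n).image fun w => innerCorner n g z + w

/-- The unit vector of the side `(i, s)` of a box: `+eᵢ` if `s`, `-eᵢ` otherwise; the box adjacent
to `B(z)` across that side is `B(z + dirVec i s)`. [cite: DuminilCopinKozmaYadin2014, §3 (adjacent boxes)] -/
def dirVec (i : Fin 2) (s : Bool) : Site 2 :=
  Pi.single i (if s then 1 else -1)

/-- The inner cardinal edge of `B(z)` on the side `(i, s)`: the translate by `innerCorner n g z`
of the cardinal edge of `[0,2n+1]²` in the middle of that side ("the edges `[(m,0),(m+1,0)]`,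
`[(2m+1,m),(2m+1,m+1)]`, `[(m,2m+1),(m+1,2m+1)]` and `[(0,m),(0,m+1)]`" with `m = n`).
[cite: DuminilCopinKozmaYadin2014, §2 (definition of P_m) and §3 (cardinal edges)] -/
def innerCardinalEdge (n g : ℕ) (z : Site 2) (i : Fin 2) (s : Bool) : Sym2 (Site 2) :=
  let p : Site 2 := innerCorner n g z +
    fun j => if j = i then (if s then 2 * (n : ℤ) + 1 else 0) else (n : ℤ)
  s(p, p + Pi.single (i + 1) 1)

/-- The rung cells of `B(z)` towards `+eᵢ`: the `2g × 2` cells of the two moats between the inner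
cardinal edge of `B(z)` on the side `(i, +)` and that of `B(z + eᵢ)` on the side `(i, -)` (in
inner coordinates: `i`-th coordinate in `[2n+2, 2n+2g+1]`, other coordinate in `{n, n+1}`);
merged polygons cross from box to box along them ("changing the edges `[cd]` and `[ab]` … into
the edges `[ac]` and `[bd]`"). [cite: DuminilCopinKozmaYadin2014, §3 (proof of the Claim)] -/
def rungCells (n g : ℕ) (z : Site 2) (i : Fin 2) : Finset (Site 2) :=
  (Finset.range (2 * g) ×ˢ Finset.range 2).image fun ab =>
    innerCorner n g z + fun j => if j = i then 2 * (n : ℤ) + 2 + ab.1 else (n : ℤ) + ab.2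

/-- The polygon region of a family `F` of boxes: the inner boxes of the boxes of `F` and the
rungs between `+eᵢ`-adjacent pairs of boxes of `F` (the tree's version of "`𝓔_F`, the set of
edges with both end-points in `V_F`", shrunk to leave the moats free).
[cite: DuminilCopinKozmaYadin2014, §3 (V_F, 𝓔_F)] -/
def polygonRegion (n g : ℕ) (F : Finset (Site 2)) : Finset (Site 2) :=
  F.biUnion (innerBox n g) ∪
    Finset.univ.biUnion fun i : Fin 2 =>
      (F.filter fun z => z + Pi.single i 1 ∈ F).biUnion fun z => rungCells n g z i

open Classical in
/-- `S_F`: "the set of self-avoiding polygons included in `𝓔_F` visiting all the edges in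
`𝓔𝓒_F`" (the external cardinal edges: "all cardinal edges in boxes of `F` which have neighbors
outside of `F`") — here the polygons of `ℤ²` (finite edge sets tracing a cycle, `IsPolygon`)
with all vertices in `polygonRegion n g F` and containing the inner cardinal edge of every box
of `F` on every side across which the adjacent box is not in `F`.
[cite: DuminilCopinKozmaYadin2014, §3 (proof of Proposition 7, S_F)] -/
def familyPolygons (n g : ℕ) (F : Finset (Site 2)) : Finset (Finset (Sym2 (Site 2))) :=
  (edgesIn (zdGraph 2) (polygonRegion n g F)).powerset.filter fun E =>
    IsPolygon (zdGraph 2) E ∧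
      ∀ z ∈ F, ∀ (i : Fin 2) (s : Bool), z + dirVec i s ∉ F → innerCardinalEdge n g z i s ∈ E

/-- `Z_F(x) = Σ_{E ∈ S_F} x^{|E|}`, "the partition function of polygons in `S_F`".
[cite: DuminilCopinKozmaYadin2014, §3 (proof of Proposition 7, Z_F)] -/
def familyPartition (n g : ℕ) (F : Finset (Site 2)) (x : ℝ) : ℝ :=
  ∑ E ∈ familyPolygons n g F, x ^ E.card

/-! ### Deep boxes of the discretised disk and boundary-near sites -/

/-- The `2N`-thickening of the box `B(z) = mBox m z` (`N = 2m+2`): the sites with coordinates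
in `[N zᵢ - 2N, N zᵢ + 2m + 1 + 2N]`. [cite: DuminilCopinKozmaYadin2014, §3 (m-boxes)] -/
def thickBox (m : ℕ) (z : Site 2) : Set (Site 2) :=
  {w | ∀ i, (2 * (m : ℤ) + 2) * z i - 2 * (2 * m + 2) ≤ w i ∧
    w i ≤ (2 * (m : ℤ) + 2) * z i + (2 * m + 1) + 2 * (2 * m + 2)}

/-- The box `B(z)` is deep in `𝔻_δ` if its `2N`-thickening lies in `𝔻_δ` (so that `B(z)`, the
boxes adjacent to it and a collar around them are `m`-boxes of `𝔻_δ` with room to spare, and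
no site near them is within `5` lattice steps of the outside of `𝔻_δ`).
[cite: DuminilCopinKozmaYadin2014, §3 (m-boxes "included in Ω_δ")] -/
def IsDeep (δ : ℝ) (m : ℕ) (z : Site 2) : Prop :=
  thickBox m z ⊆ meshDomain unitDisk δ

open Classical in
/-- The (finite) family of deep boxes of `𝔻_δ`, indexed by their corners `z` (all of them lie
in the box `{-⌈1/δ⌉, …, ⌈1/δ⌉}²`, `mem_deepBoxes`). This is the family over which the Peierls
argument of the proof of Theorem 6 is run for the disk ("the family of all boxes in `𝔻_δ` is
connected (it is an interval in every row and every column)").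
[cite: DuminilCopinKozmaYadin2014, §3 (𝓕(Ω_δ, m) and proof of Theorem 1 given Theorem 6)] -/
def deepBoxes (δ : ℝ) (m : ℕ) : Finset (Site 2) :=
  (box 2 ⌈1 / δ⌉₊).filter (IsDeep δ m)

/-- A site `u` is near the outside of `𝔻_δ`: some site outside `𝔻_δ` is within sup-distance `5`
of `u` (the closest sites `a_δ, b_δ` to boundary points are, `IsClosestSite.dist_le`).
[cite: DuminilCopinKozmaYadin2014, §1 (a_δ, b_δ)] -/
def NearOutside (δ : ℝ) (u : Site 2) : Prop :=
  ∃ w : Site 2, w ∉ meshDomain unitDisk δ ∧ ∀ i, |u i - w i| ≤ 5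

/-! ### API: membership -/

/-- Membership in the inner box: coordinates in `[N zᵢ + g, N zᵢ + g + 2n + 1]`, `N = 2(n+g)+2`.
[cite: DuminilCopinKozmaYadin2014, §3 (m-boxes)] -/
theorem mem_innerBox_iff {n g : ℕ} {z v : Site 2} :
    v ∈ innerBox n g z ↔ ∀ i, (2 * ((n + g : ℕ) : ℤ) + 2) * z i + g ≤ v i ∧
      v i ≤ (2 * ((n + g : ℕ) : ℤ) + 2) * z i + g + (2 * n + 1) := by
  simp only [innerBox, innerCorner, Finset.mem_image, mem_squareBox_iff]
  constructor
  · rintro ⟨w, hw, rfl⟩ i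
    have := hw i
    simp only [Pi.add_apply, Pi.smul_apply, smul_eq_mul]
    constructor <;> linarith [this.1, this.2]
  · intro h
    refine ⟨v - innerCorner n g z, fun i => ?_, by simp [innerCorner]⟩
    have := h i
    simp only [innerCorner, Pi.sub_apply, Pi.add_apply, Pi.smul_apply, smul_eq_mul]
    constructor <;> linarith [this.1, this.2]

/-- The inner box lies in the box. [cite: DuminilCopinKozmaYadin2014, §3 (m-boxes)] -/
theorem innerBox_subset_mBox (n g : ℕ) (z : Site 2) : innerBox n g z ⊆ mBox (n + g) z := by
  intro v hv
  rw [mem_innerBox_iff] at hv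
  rw [mem_mBox_iff]
  intro i
  have := hv i
  push_cast at this ⊢
  constructor <;> linarith [this.1, this.2]

/-- Membership in the thickened box, unfolded. [cite: DuminilCopinKozmaYadin2014, §3 (m-boxes)] -/
theorem mem_thickBox_iff {m : ℕ} {z w : Site 2} :
    w ∈ thickBox m z ↔ ∀ i, (2 * (m : ℤ) + 2) * z i - 2 * (2 * m + 2) ≤ w i ∧
      w i ≤ (2 * (m : ℤ) + 2) * z i + (2 * m + 1) + 2 * (2 * m + 2) :=
  Iff.rfl

/-- The box lies in its thickening. [cite: DuminilCopinKozmaYadin2014, §3 (m-boxes)] -/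
theorem mBox_subset_thickBox (m : ℕ) (z : Site 2) : ↑(mBox m z) ⊆ thickBox m z := by
  intro w hw
  rw [Finset.mem_coe, mem_mBox_iff] at hw
  intro i
  have := hw i
  constructor <;> nlinarith [this.1, this.2]

/-- A deep box is an `m`-box of `𝔻_δ` (it lies in `𝔻_δ`). [cite: DuminilCopinKozmaYadin2014, §3 (m-boxes)] -/
theorem IsDeep.mBox_subset {δ : ℝ} {m : ℕ} {z : Site 2} (h : IsDeep δ m z) :
    ↑(mBox m z) ⊆ meshDomain unitDisk δ :=
  (mBox_subset_thickBox m z).trans h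

/-- A site of `𝔻_δ` has coordinates of absolute value `< 1/δ` (for `δ > 0`). [folklore] -/
theorem abs_lt_of_mem_meshDomain_unitDisk {δ : ℝ} (hδ : 0 < δ) {v : Site 2}
    (hv : v ∈ meshDomain unitDisk δ) (i : Fin 2) : |((v i : ℤ) : ℝ)| < 1 / δ := by
  rw [meshDomain_unitDisk, mem_meshVertices_unitDisk_iff_sq] at hv
  rw [lt_div_iff₀ hδ]
  have hsum : ((v i : ℤ) : ℝ) ^ 2 ≤ ∑ j, ((v j : ℤ) : ℝ) ^ 2 :=
    Finset.single_le_sum (f := fun j => ((v j : ℤ) : ℝ) ^ 2) (fun j _ => sq_nonneg _)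
      (Finset.mem_univ i)
  have h1 : (|((v i : ℤ) : ℝ)| * δ) ^ 2 < 1 := by
    calc (|((v i : ℤ) : ℝ)| * δ) ^ 2 = δ ^ 2 * ((v i : ℤ) : ℝ) ^ 2 := by rw [mul_pow, sq_abs]; ring
      _ ≤ δ ^ 2 * ∑ j, ((v j : ℤ) : ℝ) ^ 2 := mul_le_mul_of_nonneg_left hsum (sq_nonneg δ)
      _ < 1 := hv
  have h2 : 0 ≤ |((v i : ℤ) : ℝ)| * δ := mul_nonneg (abs_nonneg _) hδ.le
  nlinarith [h1, h2]

/-- Membership in `deepBoxes`: for `δ > 0` these are exactly the deep boxes.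
[cite: DuminilCopinKozmaYadin2014, §3 (𝓕(Ω_δ, m))] -/
theorem mem_deepBoxes {δ : ℝ} (hδ : 0 < δ) {m : ℕ} {z : Site 2} :
    z ∈ deepBoxes δ m ↔ IsDeep δ m z := by
  classical
  rw [deepBoxes, Finset.mem_filter, and_iff_right_iff_imp]
  intro h
  -- the corner `N z` of the box lies in `𝔻_δ`, so `|z i| ≤ |N z i| < 1/δ ≤ ⌈1/δ⌉`
  have hcorner : (2 * (m : ℤ) + 2) • z ∈ meshDomain unitDisk δ := by
    apply h.mBox_subset
    rw [Finset.mem_coe, mem_mBox_iff]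
    intro i
    simp only [Pi.smul_apply, smul_eq_mul]
    constructor <;> nlinarith
  rw [mem_box]
  intro i
  have habs := abs_lt_of_mem_meshDomain_unitDisk hδ hcorner i
  simp only [Pi.smul_apply, smul_eq_mul, Int.cast_mul, Int.cast_add, Int.cast_ofNat,
    Int.cast_natCast] at habs
  have hz : |((z i : ℤ) : ℝ)| < 1 / δ := by
    refine lt_of_le_of_lt ?_ habs
    rw [abs_mul]
    have : (1 : ℝ) ≤ |2 * (m : ℝ) + 2| := by rw [abs_of_nonneg (by positivity)]; linarith
    nlinarith [abs_nonneg ((z i : ℤ) : ℝ)]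
  have hceil : (1 / δ : ℝ) ≤ (⌈1 / δ⌉₊ : ℕ) := Nat.le_ceil _
  have hlt : |((z i : ℤ) : ℝ)| < ((⌈1 / δ⌉₊ : ℕ) : ℝ) := hz.trans_le hceil
  have hlt' : |z i| < (⌈1 / δ⌉₊ : ℤ) := by exact_mod_cast hlt
  constructor <;> linarith [abs_lt.1 hlt']

/-! ### The named fact: the Claim of the proof of Proposition 7 -/

/-- **The Claim in the proof of Proposition 7 of Duminil-Copin–Kozma–Yadin 2014** ("For
`F ∈ 𝓕(Ω_δ, m)`, `Z_F(x) ≥ Z_m(x)^{|F|}`"; proof: "There exists a box `B` in `F₀` such that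
`F₀ ∖ {B}` is still connected … by changing the edges `[cd]` and `[ab]` of `γ` and `γ'` into
the edges `[ac]` and `[bd]`, one obtains a polygon in `S_F`. Furthermore, the construction is
one-to-one and we deduce `Z_{F₀}(x) ≥ Z_{F₀∖{B}}(x) Z_B(x) ≥ Z_m(x)^{|F₀|}`"), for the boxes with
moats of this file: polygons of `P_n` in the inner boxes of a nonempty connected family `F` are
merged along `|F| - 1` adjacencies at a cost of `4g` extra edges each (the rungs have length
`2g + 1`), so `Σ_{E ∈ S_F} x^{|E|} ≥ x^{4g(|F|-1)} Z_n(x)^{|F|}` for `x ≥ 0` (stated multiplied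
through by `x^{4g}`). Named fact, proved as `DKY2014_prop7_claim_holds`
(`SupercriticalSAWSpaceFillingBoxesProofs.lean`). [cite: DuminilCopinKozmaYadin2014, §3 (proof of Proposition 7, Claim)] -/
def DKY2014_prop7_claim : Prop :=
  ∀ (n g : ℕ) (x : ℝ), 0 ≤ x → ∀ F : Finset (Site 2), F.Nonempty → IsConnectedFamily F →
    x ^ (4 * g * F.card) * Zbox n x ^ F.card ≤ x ^ (4 * g) * familyPartition n g F x

end SupercriticalSAW

end Literature.Barriers.CriticalPhenomena
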